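import Summits.Ventures.LatticeQCDFlow.Exactness.SU2HeatBathLaw
import Summits.Ventures.LatticeQCDFlow.Scoring.SU2HaarClassAngle
import HarnessLib

/-!
# SU(2): a coordinate of the rotation axis is UNIFORM on `[−1, 1]` under Haar (Archimedes on the axis sphere), and the joint law of `(a₀, x₁)` — the two-angle disintegration of Haar measure

HONEST FRAMING: exact (Metropolis-corrected) sampling algorithms for lattice gauge theory;
figures of merit are autocorrelation/cost numbers at stated couplings and volumes; no
continuum-physics claim.

Venture `LatticeQCDFlow` (cell pub-lqcd), sub-topic `Scoring`; FANOUT row 5 (`s0-sun-a`), GEN-9.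
NEW WORK of the cell (placement rule).  Step 2 of row 5's route to the exact SU(2) torus formula
WITHOUT Peter–Weyl (the class-function convolution identity `χ_m ∗ χ_n = [m = n] χ_n/(n+1)` by an
explicit two-angle computation): the joint law, under the Haar probability of SU(2), of
`a₀(U) = Re tr U/2` and of the first quaternion coordinate `x₁(U) = su2x genZ1 U = −Re tr(Z₁U)/2`.

Write `U = a₀ + x₁Z₁ + x₂Z₂ + x₃Z₃`, `x⃗ = √(1 − a₀²)·n̂` with the AXIS `n̂ = su2axis U ∈ S²`
(`Exactness/SU2HeatBathLaw.lean`), and `T(U) = n̂₀ = ⟨n̂, e₁⟩` the first coordinate of the axis, so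
that `x₁ = √(1 − a₀²)·T` (`su2x_genZ1_eq_sqrt_mul_axisCoord`).  Row 9 proved
`Haar.map (a₀, n̂) = semicircleLaw ⊗ uniformSphere` (`map_a0_axis_haar`).  Here:

* §1 `integral_pow_su2x_genZ1` — `x₁` has the semicircle moments: `∫ x₁^k dHaar = (−1)^k S_k`
  (`x₁(U) = −a₀(Z₁·U)` and LEFT INVARIANCE of Haar), `S_k = semicircleMoment k`;
* §2 semicircle bookkeeping: odd moments vanish (`semicircleMoment_odd`); with
  `A_j = ∫(1 − t²)^j dSC`: `(2j+2)A_j = (2j+1)A_{j−1}` (the Stein identity of `SemicircleLaw.lean`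
  with `ψ = t(1−t²)^{j−1}`) and hence **`(2j+1)·S_{2j} = A_j`** (`semicircleMoment_even_mul`);
* §3 **`integral_pow_axisCoord`** — the moments of `T` under Haar are those of the uniform law on
  `[−1, 1]`: `∫ T^{2j} dHaar = 1/(2j+1)`, `∫ T^{2j+1} dHaar = 0` (independence of `a₀` and `n̂`:
  `∫ x₁^k = (∫ (√(1−a₀²))^k)·(∫ T^k)`);
* §4 **`uniformSphere_map_coord_zero`** — ARCHIMEDES for row 9's `uniformSphere` on `S² ⊂ ℝ³`: the
  law of one coordinate of a uniform point of the sphere is `½·Lebesgue|[−1,1]` (moment determinacy,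
  `Exactness.measure_eq_of_forall_integral_pow_eq`); **`map_a0_axisCoord_haar`** — under Haar,
  `(a₀, T)` has the PRODUCT law `semicircleLaw ⊗ ½·Lebesgue|[−1,1]`;
* §5 **`integral_a0_su2x_haar`** — the TWO-ANGLE DISINTEGRATION: for continuous `F : ℝ → ℝ → ℝ`,
  `∫ F(a₀(U), x₁(U)) dHaar(U) = ∫_{−1}^{1} (½∫_{−1}^{1} F(t, √(1−t²)·s) ds)·(2/π)√(1−t²) dt`
  — equivalently `(a₀, x₁)` is uniform on the unit disk.  With `a₀(x_θ⁻¹U) = cos θ·a₀(U) + sin θ·x₁(U)`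
  for `x_θ = cos θ + sin θ Z₁` this is the input of the convolution computation (Step 3, next file).

No new definition; nothing cited (standard facts: Archimedes' hat-box theorem; `SU(2) ≅ S³`).
-/

noncomputable section

open Real MeasureTheory intervalIntegral Set Metric
open Literature.MathematicalPhysics.QuantumFieldTheory Literature.MathematicalPhysics.QuantumLattice
open Summit.Ventures.LatticeQCDFlow.Exactness
open Summit.Ventures.LatticeQCDFlow.Theory2.Lattice

namespace Summit.Ventures.LatticeQCDFlow.Scoring

/-! ## §1. `x₁ = −a₀(Z₁·U)`: the first quaternion coordinate has the semicircle moments -/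

/-- `Z₁ = iσ₁` is special unitary. -/
theorem genZ1_mem_specialUnitaryGroup : genZ1 ∈ Matrix.specialUnitaryGroup (Fin 2) ℂ := by
  rw [Matrix.mem_specialUnitaryGroup_iff]
  refine ⟨?_, ?_⟩
  · rw [Matrix.mem_unitaryGroup_iff]
    ext i j
    fin_cases i <;> fin_cases j <;> simp [genZ1, Matrix.mul_apply, Fin.sum_univ_two]
  · simp [genZ1, Matrix.det_fin_two]

/-- `Z₁` as an element of SU(2). -/
theorem su2x_genZ1_eq_neg_su2a0_mul (U : Matrix.specialUnitaryGroup (Fin 2) ℂ) :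
    su2x genZ1 U = -su2a0 ((⟨genZ1, genZ1_mem_specialUnitaryGroup⟩ :
      Matrix.specialUnitaryGroup (Fin 2) ℂ) * U) := by
  rw [su2x, su2a0]
  simp only [Submonoid.coe_mul]
  ring

/-- **`∫ x₁^k dHaar = (−1)^k·S_k`** (`S_k` the `k`-th semicircle moment): `x₁(U) = −a₀(Z₁U)` and Haar
measure is left invariant. -/
theorem integral_pow_su2x_genZ1 (k : ℕ) :
    ∫ U, (su2x genZ1 U) ^ k ∂(haarProbability (Matrix.specialUnitaryGroup (Fin 2) ℂ)) =
      (-1) ^ k * semicircleMoment k := by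
  simp_rw [su2x_genZ1_eq_neg_su2a0_mul]
  rw [integral_mul_left_eq_self (fun V : Matrix.specialUnitaryGroup (Fin 2) ℂ => (-su2a0 V) ^ k)
    (⟨genZ1, genZ1_mem_specialUnitaryGroup⟩ : Matrix.specialUnitaryGroup (Fin 2) ℂ)]
  rw [← su2Moment_zero_eq_semicircleMoment, su2Moment, ← MeasureTheory.integral_const_mul]
  refine integral_congr_ae (Filter.Eventually.of_forall fun V => ?_)
  simp only [zero_mul, Real.exp_zero, mul_one]
  exact neg_pow (su2a0 V) k

/-! ## §2. Semicircle bookkeeping: odd moments, `A_j = ∫(1−t²)^j dSC`, `(2j+1)S_{2j} = A_j` -/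

/-- Odd semicircle moments vanish: `S_{2j+1} = 0`. -/
theorem semicircleMoment_odd (j : ℕ) : semicircleMoment (2 * j + 1) = 0 := by
  induction j with
  | zero => simpa using semicircleMoment_one
  | succ j ih =>
    have h := semicircleMoment_rec (2 * j + 2)
    rw [show 2 * j + 2 + 1 = 2 * (j + 1) + 1 by ring, show 2 * j + 2 - 1 = 2 * j + 1 by omega,
      ih, mul_zero] at h
    have hne : ((2 * j + 2 : ℕ) : ℝ) + 3 ≠ 0 := by positivity
    exact (mul_eq_zero.mp h).resolve_left hne

/-- Even semicircle moment recursion: `(2j+4)·S_{2j+2} = (2j+1)·S_{2j}`. -/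
theorem semicircleMoment_even_rec (j : ℕ) :
    (2 * (j : ℝ) + 4) * semicircleMoment (2 * j + 2) = (2 * j + 1) * semicircleMoment (2 * j) := by
  have h := semicircleMoment_rec (2 * j + 1)
  rw [show 2 * j + 1 + 1 = 2 * j + 2 by ring, show 2 * j + 1 - 1 = 2 * j by omega] at h
  have e : ((2 * j + 1 : ℕ) : ℝ) + 3 = 2 * (j : ℝ) + 4 := by push_cast; ring
  rw [e] at h
  rw [h]; push_cast; ring

/-- **The recursion of `A_j = ∫(1−t²)^j dSC`**: `(2j+4)·A_{j+1} = (2j+3)·A_j` (the Stein identity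
`∫[(1−t²)ψ′ − 3tψ] dSC = 0` with `ψ = t(1−t²)^j`). -/
theorem integral_one_sub_sq_pow_rec (j : ℕ) :
    (2 * (j : ℝ) + 4) * ∫ t in (-1 : ℝ)..1, (1 - t ^ 2) ^ (j + 1) * semicircleDensity t =
      (2 * j + 3) * ∫ t in (-1 : ℝ)..1, (1 - t ^ 2) ^ j * semicircleDensity t := by
  -- Stein with ψ(t) = t (1 − t²)^j, ψ'(t) = (1 − t²)^j − 2j t² (1 − t²)^(j-1)… written without `j − 1`:
  -- ψ'(t) (1 − t²) = (1 − t²)^(j+1) − 2 j t² (1 − t²)^j.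
  have hψ : ∀ x : ℝ, HasDerivAt (fun t : ℝ => t * (1 - t ^ 2) ^ j)
      ((1 - x ^ 2) ^ j + x * ((j : ℝ) * (1 - x ^ 2) ^ (j - 1) * (-(2 * x)))) x := by
    intro x
    have h1 : HasDerivAt (fun t : ℝ => 1 - t ^ 2) (-(2 * x)) x := by
      simpa using ((hasDerivAt_pow 2 x).const_sub 1)
    have h2 : HasDerivAt (fun t : ℝ => (1 - t ^ 2) ^ j) ((j : ℝ) * (1 - x ^ 2) ^ (j - 1) * (-(2 * x))) x :=
      h1.pow j
    have h3 : HasDerivAt (fun t : ℝ => t * (1 - t ^ 2) ^ j)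
        (1 * (1 - x ^ 2) ^ j + x * ((j : ℝ) * (1 - x ^ 2) ^ (j - 1) * (-(2 * x)))) x :=
      (hasDerivAt_id' x).mul h2
    exact h3.congr_deriv (by ring)
  have hcont : Continuous fun x : ℝ =>
      (1 - x ^ 2) ^ j + x * ((j : ℝ) * (1 - x ^ 2) ^ (j - 1) * (-(2 * x))) := by fun_prop
  have hst := semicircle_stein hψ hcont
  -- pointwise: (1 − t²)ψ' − 3tψ = (2j+4)(1−t²)^(j+1) − (2j+3)(1−t²)^j  (multiply out, t² = 1 − (1−t²))
  have hpt : ∀ t : ℝ, ((1 - t ^ 2) * ((1 - t ^ 2) ^ j + t * ((j : ℝ) * (1 - t ^ 2) ^ (j - 1) *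
      (-(2 * t)))) - 3 * t * (t * (1 - t ^ 2) ^ j)) * semicircleDensity t =
      (2 * (j : ℝ) + 4) * ((1 - t ^ 2) ^ (j + 1) * semicircleDensity t) -
        (2 * j + 3) * ((1 - t ^ 2) ^ j * semicircleDensity t) := by
    intro t
    rcases Nat.eq_zero_or_pos j with hj | hj
    · subst hj; simp; ring
    · obtain ⟨i, rfl⟩ : ∃ i, j = i + 1 := ⟨j - 1, by omega⟩
      simp only [Nat.add_sub_cancel]
      push_cast
      ring
  simp_rw [hpt] at hst
  have hi : ∀ (r : ℝ) (i : ℕ), IntervalIntegrable (fun t : ℝ => r * ((1 - t ^ 2) ^ i * semicircleDensity t))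
      volume (-1) 1 := fun r i =>
    (continuous_const.mul (((continuous_const.sub (continuous_pow 2)).pow i).mul
      continuous_semicircleDensity)).intervalIntegrable _ _
  rw [intervalIntegral.integral_sub (hi _ _) (hi _ _), intervalIntegral.integral_const_mul,
    intervalIntegral.integral_const_mul] at hst
  linarith

/-- **`(2j+1)·S_{2j} = A_j`**: the even semicircle moments against the moments of `1 − t²`
(both sides satisfy the same first-order recursion, `S₀ = A₀ = 1`). -/
theorem semicircleMoment_even_mul (j : ℕ) :
    (2 * (j : ℝ) + 1) * semicircleMoment (2 * j) =
      ∫ t in (-1 : ℝ)..1, (1 - t ^ 2) ^ j * semicircleDensity t := by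
  induction j with
  | zero =>
    have h0 := semicircleMoment_zero
    simp only [semicircleMoment, pow_zero, one_mul] at h0 ⊢
    simp [h0]
  | succ j ih =>
    have h1 := semicircleMoment_even_rec j
    have h2 := integral_one_sub_sq_pow_rec j
    have hne : (2 * (j : ℝ) + 4) ≠ 0 := by positivity
    -- (2j+3) S_{2j+2} = (2j+3)(2j+1) S_{2j}/(2j+4) = (2j+3) A_j/(2j+4) = A_{j+1}
    have e : 2 * ((j + 1 : ℕ) : ℝ) + 1 = 2 * j + 3 := by push_cast; ring
    rw [e, show 2 * (j + 1) = 2 * j + 2 by ring]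
    apply mul_left_cancel₀ hne
    calc (2 * (j : ℝ) + 4) * ((2 * j + 3) * semicircleMoment (2 * j + 2))
        = (2 * j + 3) * ((2 * (j : ℝ) + 4) * semicircleMoment (2 * j + 2)) := by ring
      _ = (2 * j + 3) * ((2 * (j : ℝ) + 1) * semicircleMoment (2 * j)) := by rw [h1]
      _ = (2 * j + 3) * ∫ t in (-1 : ℝ)..1, (1 - t ^ 2) ^ j * semicircleDensity t := by rw [ih]
      _ = _ := by rw [h2]

/-- `A_j > 0` (the integrand `(1 − t²)^j·(2/π)√(1 − t²)` is positive on `(−1, 1)`). -/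
theorem integral_one_sub_sq_pow_pos (j : ℕ) :
    0 < ∫ t in (-1 : ℝ)..1, (1 - t ^ 2) ^ j * semicircleDensity t := by
  refine intervalIntegral_pos_of_pos_on ?_ (fun t ht => ?_) (by norm_num)
  · exact ((((continuous_const.sub (continuous_pow 2)).pow j)).mul
      continuous_semicircleDensity).intervalIntegrable _ _
  · have h1 : 0 < 1 - t ^ 2 := by nlinarith [ht.1, ht.2]
    have hd : 0 < semicircleDensity t := by
      unfold semicircleDensity
      exact mul_pos (by positivity) (Real.sqrt_pos.mpr h1)
    exact mul_pos (pow_pos h1 j) hd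

/-- The odd companions `C_{2j+1} = ∫ (√(1 − t²))^(2j+1) dSC > 0`. -/
theorem integral_sqrt_one_sub_sq_pow_pos (k : ℕ) :
    0 < ∫ t in (-1 : ℝ)..1, Real.sqrt (1 - t ^ 2) ^ k * semicircleDensity t := by
  refine intervalIntegral_pos_of_pos_on ?_ (fun t ht => ?_) (by norm_num)
  · exact (((continuous_const.sub (continuous_pow 2)).sqrt.pow k).mul
      continuous_semicircleDensity).intervalIntegrable _ _
  · have h1 : 0 < 1 - t ^ 2 := by nlinarith [ht.1, ht.2]
    have hs : 0 < Real.sqrt (1 - t ^ 2) := Real.sqrt_pos.mpr h1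
    have hd : 0 < semicircleDensity t := by
      unfold semicircleDensity
      exact mul_pos (by positivity) hs
    exact mul_pos (pow_pos hs k) hd

/-- On `[−1, 1]`: `∫ (√(1 − t²))^(2j) dSC = A_j`. -/
theorem integral_sqrt_one_sub_sq_pow_even (j : ℕ) :
    ∫ t in (-1 : ℝ)..1, Real.sqrt (1 - t ^ 2) ^ (2 * j) * semicircleDensity t =
      ∫ t in (-1 : ℝ)..1, (1 - t ^ 2) ^ j * semicircleDensity t := by
  refine intervalIntegral.integral_congr fun t ht => ?_
  rw [uIcc_of_le (by norm_num : (-1 : ℝ) ≤ 1)] at ht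
  have h1 : 0 ≤ 1 - t ^ 2 := by nlinarith [ht.1, ht.2]
  rw [pow_mul, Real.sq_sqrt h1]

/-! ## §3. The axis coordinate `T = n̂₀`: `x₁ = √(1 − a₀²)·T`, and its Haar moments -/

/-- The first coordinate of the vector part is `x₁`. -/
theorem su2vec_apply_zero (U : Matrix.specialUnitaryGroup (Fin 2) ℂ) : su2vec U 0 = su2x genZ1 U := by
  simp [su2vec]

/-- `‖x⃗‖² = 1 − a₀²`. -/
theorem norm_su2vec_sq (U : Matrix.specialUnitaryGroup (Fin 2) ℂ) : ‖su2vec U‖ ^ 2 = 1 - su2a0 U ^ 2 := by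
  rw [EuclideanSpace.real_norm_sq_eq, Fin.sum_univ_three]
  have h := su2_sum_sq U
  simp [su2vec]
  linarith

/-- `‖x⃗‖ = √(1 − a₀²)`. -/
theorem norm_su2vec_eq (U : Matrix.specialUnitaryGroup (Fin 2) ℂ) :
    ‖su2vec U‖ = Real.sqrt (1 - su2a0 U ^ 2) := by
  rw [← norm_su2vec_sq, Real.sqrt_sq (norm_nonneg _)]

/-- **`x₁ = √(1 − a₀²)·T`** with `T = (su2axis U)₀` the first coordinate of the axis (valid for EVERY
`U`: at `U = ±1`, where the axis is a junk value, both sides vanish). -/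
theorem su2x_genZ1_eq_sqrt_mul_axisCoord (U : Matrix.specialUnitaryGroup (Fin 2) ℂ) :
    su2x genZ1 U = Real.sqrt (1 - su2a0 U ^ 2) * (su2axis U : E3) 0 := by
  rw [← norm_su2vec_eq]
  by_cases hv : su2vec U = 0
  · have h0 : su2x genZ1 U = 0 := by rw [← su2vec_apply_zero, hv]; rfl
    rw [h0, hv, norm_zero, zero_mul]
  · rw [su2axis, dirSphere_coe hv, PiLp.smul_apply, smul_eq_mul, su2vec_apply_zero, ← mul_assoc,
      mul_inv_cancel₀ (norm_ne_zero_iff.mpr hv), one_mul]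

/-- A coordinate of a point of the unit sphere lies in `[−1, 1]`. -/
theorem sphere_coord_mem_Icc (n : sphere (0 : E3) 1) (i : Fin 3) : (n : E3) i ∈ Icc (-1 : ℝ) 1 := by
  have h1 : ‖(n : E3)‖ = 1 := by simp
  have h2 : ((n : E3) i) ^ 2 ≤ ‖(n : E3)‖ ^ 2 := by
    rw [EuclideanSpace.real_norm_sq_eq]
    exact Finset.single_le_sum (f := fun j => ((n : E3) j) ^ 2) (fun j _ => sq_nonneg _)
      (Finset.mem_univ i)
  rw [h1, one_pow] at h2
  constructor <;> nlinarith [h2, sq_nonneg ((n : E3) i)]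

/-- The coordinate map on the sphere is measurable. -/
theorem measurable_sphere_coord (i : Fin 3) : Measurable fun n : sphere (0 : E3) 1 => (n : E3) i :=
  ((EuclideanSpace.proj i).continuous.comp continuous_subtype_val).measurable

/-- **Factorisation of the `x₁`-moments** (independence of `a₀` and the axis, row 9's
`map_a0_axis_haar`): `∫ x₁^k dHaar = (∫ (√(1−t²))^k dSC(t)) · (∫ n₀^k dσ(n))`. -/
theorem integral_pow_su2x_genZ1_eq_mul (k : ℕ) :
    ∫ U, (su2x genZ1 U) ^ k ∂(haarProbability (Matrix.specialUnitaryGroup (Fin 2) ℂ)) =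
      (∫ t in (-1 : ℝ)..1, Real.sqrt (1 - t ^ 2) ^ k * semicircleDensity t) *
        ∫ n, ((n : E3) 0) ^ k ∂(uniformSphere (volume : Measure E3)) := by
  simp_rw [su2x_genZ1_eq_sqrt_mul_axisCoord, mul_pow]
  have hφ : Measurable fun t : ℝ => Real.sqrt (1 - t ^ 2) ^ k :=
    ((continuous_const.sub (continuous_pow 2)).sqrt.pow k).measurable
  have hψ : Measurable fun n : sphere (0 : E3) 1 => ((n : E3) 0) ^ k :=
    (measurable_sphere_coord 0).pow_const k
  have hG : Measurable fun p : ℝ × sphere (0 : E3) 1 => Real.sqrt (1 - p.1 ^ 2) ^ k *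
      ((p.2 : E3) 0) ^ k := (hφ.comp measurable_fst).mul (hψ.comp measurable_snd)
  have key : ∫ U, Real.sqrt (1 - su2a0 U ^ 2) ^ k * ((su2axis U : E3) 0) ^ k
        ∂(haarProbability (Matrix.specialUnitaryGroup (Fin 2) ℂ)) =
      ∫ p, Real.sqrt (1 - p.1 ^ 2) ^ k * ((p.2 : E3) 0) ^ k
        ∂((haarProbability (Matrix.specialUnitaryGroup (Fin 2) ℂ)).map fun U => (su2a0 U, su2axis U)) := by
    rw [integral_map measurable_a0_axis.aemeasurable hG.aestronglyMeasurable]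
  rw [key, map_a0_axis_haar, integral_prod_mul (fun t : ℝ => Real.sqrt (1 - t ^ 2) ^ k)
    (fun n : sphere (0 : E3) 1 => ((n : E3) 0) ^ k), integral_semicircleLaw]

/-- **The Haar moments of the axis coordinate are the uniform moments**:
`∫ n₀^(2j) dσ = 1/(2j+1)` and `∫ n₀^(2j+1) dσ = 0` for row 9's `uniformSphere` on `S² ⊂ ℝ³`. -/
theorem integral_pow_sphere_coord (k : ℕ) :
    ∫ n, ((n : E3) 0) ^ k ∂(uniformSphere (volume : Measure E3)) =
      if Even k then 1 / ((k : ℝ) + 1) else 0 := by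
  have hfac := integral_pow_su2x_genZ1_eq_mul k
  rw [integral_pow_su2x_genZ1] at hfac
  have hC := integral_sqrt_one_sub_sq_pow_pos k
  rcases Nat.even_or_odd k with ⟨j, rfl⟩ | ⟨j, rfl⟩
  · -- even: (2j+1) S_{2j} = A_j = C_{2j}
    rw [if_pos ⟨j, rfl⟩]
    rw [show j + j = 2 * j by ring] at hfac hC ⊢
    rw [integral_sqrt_one_sub_sq_pow_even, Even.neg_one_pow (even_two_mul j), one_mul] at hfac
    have hA := semicircleMoment_even_mul j
    have hApos := integral_one_sub_sq_pow_pos j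
    have hne : (2 * (j : ℝ) + 1) ≠ 0 := by positivity
    -- S = A * M and (2j+1) S = A ⇒ M = 1/(2j+1)
    have hM : ∫ n, ((n : E3) 0) ^ (2 * j) ∂(uniformSphere (volume : Measure E3)) =
        semicircleMoment (2 * j) / ∫ t in (-1 : ℝ)..1, (1 - t ^ 2) ^ j * semicircleDensity t := by
      rw [eq_div_iff hApos.ne', mul_comm]; exact hfac.symm
    rw [hM, div_eq_iff hApos.ne', ← hA]
    push_cast
    rw [← mul_assoc, one_div_mul_cancel hne, one_mul]
  · -- odd: S_{2j+1} = 0 = C_{2j+1} M ⇒ M = 0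
    rw [if_neg (Nat.not_even_iff_odd.mpr ⟨j, rfl⟩)]
    rw [semicircleMoment_odd, mul_zero] at hfac
    exact (mul_eq_zero.mp hfac.symm).resolve_left hC.ne'

/-! ## §4. Archimedes on the axis sphere and the product law of `(a₀, T)` -/

/-- The moments of `½·Lebesgue|[−1,1]`: `½∫_{−1}^{1} s^k ds = [k even]/(k+1)`. -/
theorem integral_pow_uniformIcc (k : ℕ) :
    ∫ s, s ^ k ∂((2⁻¹ : NNReal) • (volume.restrict (Icc (-1 : ℝ) 1))) =
      if Even k then 1 / ((k : ℝ) + 1) else 0 := by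
  rw [integral_smul_nnreal_measure]
  have h : ∫ s in Icc (-1 : ℝ) 1, s ^ k = ∫ s in (-1 : ℝ)..1, s ^ k := by
    rw [intervalIntegral.integral_of_le (by norm_num), integral_Icc_eq_integral_Ioc]
  rw [h, integral_pow]
  rcases Nat.even_or_odd k with ⟨j, rfl⟩ | ⟨j, rfl⟩
  · rw [if_pos ⟨j, rfl⟩, show j + j + 1 = 2 * j + 1 by ring, Odd.neg_one_pow ⟨j, rfl⟩]
    simp only [NNReal.smul_def, NNReal.coe_inv, NNReal.coe_ofNat, smul_eq_mul, one_pow]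
    push_cast
    ring
  · rw [if_neg (Nat.not_even_iff_odd.mpr ⟨j, rfl⟩), show 2 * j + 1 + 1 = 2 * (j + 1) by ring,
      Even.neg_one_pow ⟨j + 1, by ring⟩]
    simp

/-- **Archimedes' theorem for row 9's uniform sphere measure**: the law of one coordinate of a
uniformly distributed point of `S² ⊂ ℝ³` is the uniform law `½·Lebesgue|[−1,1]`. -/
theorem uniformSphere_map_coord_zero :
    (uniformSphere (volume : Measure E3)).map (fun n : sphere (0 : E3) 1 => (n : E3) 0) =
      (2⁻¹ : NNReal) • (volume.restrict (Icc (-1 : ℝ) 1)) := by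
  have hm := measurable_sphere_coord 0
  haveI : IsProbabilityMeasure ((uniformSphere (volume : Measure E3)).map
      (fun n : sphere (0 : E3) 1 => (n : E3) 0)) := Measure.isProbabilityMeasure_map hm.aemeasurable
  refine measure_eq_of_forall_integral_pow_eq (a := -1) (b := 1) ?_ ?_ fun k => ?_
  · rw [Measure.map_apply hm measurableSet_Icc.compl]
    have : (fun n : sphere (0 : E3) 1 => (n : E3) 0) ⁻¹' (Icc (-1 : ℝ) 1)ᶜ = ∅ := by
      ext n
      simp only [mem_preimage, mem_compl_iff, mem_empty_iff_false, iff_false, not_not]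
      exact sphere_coord_mem_Icc n 0
    rw [this, measure_empty]
  · rw [Measure.smul_apply, Measure.restrict_apply measurableSet_Icc.compl, compl_inter_self,
      measure_empty, smul_zero]
  · rw [integral_map hm.aemeasurable (continuous_pow k).aestronglyMeasurable,
      integral_pow_sphere_coord, integral_pow_uniformIcc]

/-- The pair (`a₀`, `T`) is measurable. -/
theorem measurable_a0_axisCoord :
    Measurable fun U : Matrix.specialUnitaryGroup (Fin 2) ℂ => (su2a0 U, (su2axis U : E3) 0) :=
  continuous_su2a0.measurable.prodMk ((measurable_sphere_coord 0).comp measurable_su2axis)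

/-- **The product law of `(a₀, T)` under Haar**: `a₀ = Re tr U/2` and the axis coordinate `T = n̂₀`
are INDEPENDENT, `a₀` semicircle-distributed and `T` UNIFORM on `[−1, 1]`. -/
theorem map_a0_axisCoord_haar :
    (haarProbability (Matrix.specialUnitaryGroup (Fin 2) ℂ)).map
        (fun U => (su2a0 U, (su2axis U : E3) 0)) =
      semicircleLaw.prod ((2⁻¹ : NNReal) • (volume.restrict (Icc (-1 : ℝ) 1))) := by
  have hm := measurable_sphere_coord 0
  have h1 : (fun U : Matrix.specialUnitaryGroup (Fin 2) ℂ => (su2a0 U, (su2axis U : E3) 0)) =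
      (Prod.map id fun n : sphere (0 : E3) 1 => (n : E3) 0) ∘ fun U => (su2a0 U, su2axis U) := by
    funext U; rfl
  rw [h1, ← Measure.map_map (measurable_id.prodMap hm) measurable_a0_axis, map_a0_axis_haar,
    ← Measure.map_prod_map _ _ measurable_id hm, Measure.map_id, uniformSphere_map_coord_zero]

end Summit.Ventures.LatticeQCDFlow.Scoring
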